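import Summits.BirchSwinnertonDyer.BirchSwinnertonDyer.Theorems.ManinLocalTwoThreeManinPrimeToAdditiveFiveLeBistarredGord
import Summits.BirchSwinnertonDyer.BirchSwinnertonDyer.Theses.TwistFamilyManinDescent
import Literature.NumberTheory.EllipticCurves.RootNumberProofs
import Literature.NumberTheory.EllipticCurves.RootNumberSmulProofs
import HarnessLib

/-!
# Route `ManinLocalTwoThree`, residual crux C5 `ManinPrimeToAdditiveFiveLe`
# (stmt-BirchSwinnertonDyer-22969), line `upper_anchor` (skeleton v8, registered stub
# `stub_red57unstarredOffIIAtFive` = the ANCHOR): **its two Raynaud rows (5; IV) and (7; III) are the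
# TwistFamilyManinDescent route's registered item K15b `SupersingularUnstarredStrongManinUnit`
# (stmt-BirchSwinnertonDyer-27071) BY NAME**

Width seat bsd-line-ml23-c5-p1-w2 (gen 4), piece υ4. The ANCHOR stub of skeleton v8 (`Cruxes/ManinPrimeToAdditiveFiveLe/
Lines/upper_anchor.lean`, sha16 f41b6313bdbd3fbd; promoted «crux-sized, ownerless» by the lead gen 4) is Manin's
`p ∤ c(D)` for the lattice-optimal, `W[p]`-reducible, globally twist-minimal, UNSTARRED curves at the five Kodaira
cells (5; III), (5; IV), (7; II), (7; III), (7; IV). Two of these cells — the potentially supersingular «Raynaud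
rows» (5; IV) (`ord₅ Δ_min = 4`, `e = 3 < 4`) and (7; III) (`ord₇ Δ_min = 3`, `e = 4 < 6`) — are EXACTLY the
registered crux K15b `Summit.BirchSwinnertonDyer.BirchSwinnertonDyer.Theses.TwistFamilyManinDescent.SupersingularUnstarredStrongManinUnit`
(stmt-BirchSwinnertonDyer-27071, route `TwistFamilyManinDescent`, planner bsd-idea-3: «`p ∤ c` for the
lattice-optimal curve on the rows (5; IV), (7; III), `p² ∣ N`, `W[p]` reducible, `W ⊗ p*` still additive at `p`»;
mechanism offered there: Edixhoven's thesis Thm 4.3.2 + Lemma 4.6.4 + Prop 4.2.4 at `(p, d) ∈ {(5,3),(7,4)}`). So,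
exactly as KP57 enters the line BY NAME as stmt-23810, these two anchor cells can enter BY NAME as stmt-27071:

* `quadraticTwist_pStar_additive_of_twistMinimal` — plumbing: for `W` with `p² ∣ N(W)` and the line's odd
  twist-minimality clause, the twist `W ⊗ χ_{p*}` is neither good nor multiplicative at the place `(p)` (else its
  globally minimal model `W′` has `p² ∤ N(W′)` and `W ∼ W′ ⊗ p*`, an excluded untwist).
* `red57unstarredOffIIAtFive_of_offRaynaud_of_ssUnstarredStrong` — **the ANCHOR stub VERBATIM ⟸ K15b (stmt-27071)
  ∧ the ANCHOR stub restricted OFF the Raynaud rows** (two extra binders `p = 5 → ord_p Δ_min ≠ 4`,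
  `p = 7 → ord_p Δ_min ≠ 3`; what is left: (5; III) [`e = 4 = p − 1`], (7; II) [`e = 6 = p − 1`], (7; IV)
  [`e = 3`, potentially ORDINARY, Edixhoven case 1] — the three cells where Raynaud's `e < p − 1` fails or the
  reduction is ordinary).

Net effect on the line's ledger (with υ p626338, υ2 p626766, υ3): residual of C5 = {ANCHOR[(5;III),(7;II),(7;IV)],
K15b stmt-27071, KP57 stmt-23810, E-imc-5(5) ∧ E-imc-5(7), E-imc-9(13), eight cite-only prints}. HONEST STATUS:
conditional-result helpers (`--supports … --as helper`); K15b is an OPEN item of another route (beyond print at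
`p ≤ 7`); nothing here proves BSD, Manin's conjecture, K15b or C5.

References: [EdixhovenManin1991] Prop. 7, Thm. 3; Edixhoven's thesis (Utrecht 1989) Thm 4.3.2, Lemma 4.6.4,
Prop 4.2.4 (as cited by the K15b item); [Raynaud1974] Cor. 3.3.6; [SilvermanAEC2009] VII.5 Prop. 5.1 (reduction
types and the conductor); [SilvermanATAEC1994] IV Table 4.1.
-/

set_option autoImplicit false
-- the Theorems namespace of this sub repeats the summit name by design (D-0017 nested layout)
set_option linter.dupNamespace false

noncomputable section

open scoped Classical NumberField

namespace Summit.BirchSwinnertonDyer.BirchSwinnertonDyer.Theorems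

open WeierstrassCurve IsDedekindDomain IsDedekindDomain.HeightOneSpectrum Rat.HeightOneSpectrum NumberField
  Literature.NumberTheory.EllipticCurves Literature.NumberTheory.EllipticCurves.ModularForms
  Literature.NumberTheory.EllipticCurves.Rank1Residual
  Summit.BirchSwinnertonDyer.Rank1Residual.ManinAdditive
  Summit.BirchSwinnertonDyer.Rank1Residual.Additive
  Summit.BirchSwinnertonDyer.BirchSwinnertonDyer.Theses.EdixhovenFibreFiveSeven

/-! ## §1 Plumbing: under the line's twist-minimality clause the `p*`-twist is additive at `p` -/

/-- **The `χ_{p*}`-twist of a twist-minimal curve with `p² ∣ N` is additive at `p`** (neither good nor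
multiplicative at the place `(p)` of `ℤ`): otherwise a globally minimal model `W′` of `W ⊗ p*` has `p² ∤ N(W′)`
(`not_good_and_not_mult_of_sq_dvd_conductorNorm`, contraposed; `conductorNorm_smul`), while
`W ≅ (W ⊗ p*) ⊗ p* ∼ W′ ⊗ p*` — an untwist excluded by the clause. [cite: SilvermanAEC2009, VII.5 Prop. 5.1] -/
theorem quadraticTwist_pStar_additive_of_twistMinimal (W : WeierstrassCurve ℚ) [W.IsElliptic]
    {p : ℕ} (hp : p.Prime) (hp2 : p ≠ 2) (hpN : p ^ 2 ∣ W.conductorNorm ℤ)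
    (hodd : ¬ (∃ (W' : WeierstrassCurve ℚ) (q : ℕ), W'.IsElliptic ∧ W'.IsGloballyMinimal ∧ q.Prime ∧
        q ≠ 2 ∧ q ^ 2 ∣ W.conductorNorm ℤ ∧
        IsIsogenous W (W'.quadraticTwist (((-1 : ℤ) ^ (q / 2) * q : ℤ) : ℚ)) ∧
        ¬ q ^ 2 ∣ W'.conductorNorm ℤ)) :
    ¬ ((W.quadraticTwist (((-1 : ℤ) ^ (p / 2) * p : ℤ) : ℚ)).HasGoodReductionAt
          ((Rat.HeightOneSpectrum.primesEquiv (R := ℤ)).symm ⟨p, hp⟩) ∨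
        (W.quadraticTwist (((-1 : ℤ) ^ (p / 2) * p : ℤ) : ℚ)).HasMultiplicativeReductionAt
          ((Rat.HeightOneSpectrum.primesEquiv (R := ℤ)).symm ⟨p, hp⟩)) := by
  haveI : Fact p.Prime := ⟨hp⟩
  haveI : NeZero (2 : ℚ) := ⟨two_ne_zero⟩
  have hd0 : ((((-1 : ℤ) ^ (p / 2) * p : ℤ)) : ℚ) ≠ 0 := by
    push_cast
    exact mul_ne_zero (pow_ne_zero _ (by norm_num)) (by exact_mod_cast hp.ne_zero)
  set T : WeierstrassCurve ℚ := W.quadraticTwist ((((-1 : ℤ) ^ (p / 2) * p : ℤ)) : ℚ) with hT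
  haveI hTe : T.IsElliptic := W.isElliptic_quadraticTwist hd0
  intro hgm
  obtain ⟨C, hCmin⟩ := hasGlobalMinimalModel_rat_holds T
  haveI := hCmin
  haveI : (T.quadraticTwist ((((-1 : ℤ) ^ (p / 2) * p : ℤ)) : ℚ)).IsElliptic := T.isElliptic_quadraticTwist hd0
  haveI : ((C • T).quadraticTwist ((((-1 : ℤ) ^ (p / 2) * p : ℤ)) : ℚ)).IsElliptic :=
    (C • T).isElliptic_quadraticTwist hd0
  -- `W ∼ (C • T) ⊗ p*`
  have htw : IsIsogenous W ((C • T).quadraticTwist ((((-1 : ℤ) ^ (p / 2) * p : ℤ)) : ℚ)) := by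
    obtain ⟨Cq, hCq⟩ := W.exists_variableChange_smul_eq_quadraticTwist_sq hd0
    have h1 : IsIsogenous W (T.quadraticTwist ((((-1 : ℤ) ^ (p / 2) * p : ℤ)) : ℚ)) := by
      rw [hT, quadraticTwist_quadraticTwist, ← sq, ← hCq]
      exact isIsogenous_smul _ _
    exact h1.trans' ((isIsogenous_smul T C).quadraticTwist hd0)
  -- hence `p² ∣ N(C • T) = N(T)` by the twist-minimality clause
  have hsq : p ^ 2 ∣ T.conductorNorm ℤ := by
    by_contra hns
    refine hodd ⟨C • T, p, inferInstance, hCmin, hp, hp2, hpN, htw, ?_⟩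
    rwa [conductorNorm_smul]
  obtain ⟨hng, hnm⟩ := not_good_and_not_mult_of_sq_dvd_conductorNorm T hsq
  rcases hgm with hg | hm
  · exact hng ((T.hasGoodReductionAtPrime_iff_hasGoodReductionAt_holds ⟨p, hp⟩).mpr hg)
  · exact hnm ((T.hasMultiplicativeReductionAtPrime_iff_hasMultiplicativeReductionAt_holds ⟨p, hp⟩).mpr hm)

/-! ## §2 The ANCHOR stub from K15b and its off-Raynaud restriction -/

/-- **`stub_red57unstarredOffIIAtFive` (skeleton v8 of line `upper_anchor` = hypothesis `hA` of p622240, VERBATIM)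
⟸ K15b `TwistFamilyManinDescent.SupersingularUnstarredStrongManinUnit` (stmt-BirchSwinnertonDyer-27071) ∧ the
same stub OFF the Raynaud rows** (extra binders `p = 5 → ord_p Δ_min ≠ 4` and `p = 7 → ord_p Δ_min ≠ 3`). On the
rows (5; IV) / (7; III) the stub's hypotheses feed K15b directly (level = conductor; twist additive at `p` by §1);
elsewhere the restricted stub applies. Conditional result (open item of another route + open residual); closes nothing.
[cite: EdixhovenManin1991, Prop. 7 and Thm. 3] [cite: SilvermanATAEC1994, IV Table 4.1] -/
theorem red57unstarredOffIIAtFive_of_offRaynaud_of_ssUnstarredStrong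
    (hK : Summit.BirchSwinnertonDyer.BirchSwinnertonDyer.Theses.TwistFamilyManinDescent.SupersingularUnstarredStrongManinUnit)
    (hA' : mazur_not_dvd_maninConstant_of_odd → abbesUllmo_not_dvd_maninConstant_of_not_dvd_level →
      cesnavicius_not_two_dvd_maninConstant_of_two_dvd_level → exists_isNewformOf →
      ∀ (W : WeierstrassCurve ℚ) [W.IsElliptic] [W.IsGloballyMinimal] [NeZero (W.conductorNorm ℤ)]
        (D : ModularParametrizationData W (W.conductorNorm ℤ)),
        IsLatticeOptimal D → ∀ (p : ℕ) (hp : p.Prime), (p = 5 ∨ p = 7) → p ^ 2 ∣ W.conductorNorm ℤ →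
        ¬ (∃ (W' : WeierstrassCurve ℚ) (q : ℕ), W'.IsElliptic ∧ W'.IsGloballyMinimal ∧ q.Prime ∧
            q ≠ 2 ∧ q ^ 2 ∣ W.conductorNorm ℤ ∧
            IsIsogenous W (W'.quadraticTwist (((-1 : ℤ) ^ (q / 2) * q : ℤ) : ℚ)) ∧
            ¬ q ^ 2 ∣ W'.conductorNorm ℤ) →
        ¬ (∃ (W' : WeierstrassCurve ℚ) (d : ℤ), W'.IsElliptic ∧ W'.IsGloballyMinimal ∧
            (d = -1 ∨ d = 2 ∨ d = -2) ∧ 2 ^ 2 ∣ W.conductorNorm ℤ ∧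
            IsIsogenous W (W'.quadraticTwist (d : ℚ)) ∧ ¬ 2 ^ 2 ∣ W'.conductorNorm ℤ) →
        ¬ W.HasIrreducibleModPGaloisRep p →
        500000 < W.conductorNorm ℤ →
        p ∣ D.modularDegree →
        (∀ n : ℕ, W.kodairaSymbolAt ((Rat.HeightOneSpectrum.primesEquiv (R := ℤ)).symm ⟨p, hp⟩) ≠
          .Istar n) →
        padicValInt p W.minimalDiscriminantInt ≤ 4 →
        (p = 5 → padicValInt p W.minimalDiscriminantInt ≠ 2) →
        (p = 5 → padicValInt p W.minimalDiscriminantInt ≠ 4) →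
        (p = 7 → padicValInt p W.minimalDiscriminantInt ≠ 3) →
        ¬ (p : ℤ) ∣ D.maninConstant) :
    mazur_not_dvd_maninConstant_of_odd → abbesUllmo_not_dvd_maninConstant_of_not_dvd_level →
    cesnavicius_not_two_dvd_maninConstant_of_two_dvd_level → exists_isNewformOf →
    ∀ (W : WeierstrassCurve ℚ) [W.IsElliptic] [W.IsGloballyMinimal] [NeZero (W.conductorNorm ℤ)]
      (D : ModularParametrizationData W (W.conductorNorm ℤ)),
      IsLatticeOptimal D → ∀ (p : ℕ) (hp : p.Prime), (p = 5 ∨ p = 7) → p ^ 2 ∣ W.conductorNorm ℤ →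
      ¬ (∃ (W' : WeierstrassCurve ℚ) (q : ℕ), W'.IsElliptic ∧ W'.IsGloballyMinimal ∧ q.Prime ∧
          q ≠ 2 ∧ q ^ 2 ∣ W.conductorNorm ℤ ∧
          IsIsogenous W (W'.quadraticTwist (((-1 : ℤ) ^ (q / 2) * q : ℤ) : ℚ)) ∧
          ¬ q ^ 2 ∣ W'.conductorNorm ℤ) →
      ¬ (∃ (W' : WeierstrassCurve ℚ) (d : ℤ), W'.IsElliptic ∧ W'.IsGloballyMinimal ∧
          (d = -1 ∨ d = 2 ∨ d = -2) ∧ 2 ^ 2 ∣ W.conductorNorm ℤ ∧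
          IsIsogenous W (W'.quadraticTwist (d : ℚ)) ∧ ¬ 2 ^ 2 ∣ W'.conductorNorm ℤ) →
      ¬ W.HasIrreducibleModPGaloisRep p →
      500000 < W.conductorNorm ℤ →
      p ∣ D.modularDegree →
      (∀ n : ℕ, W.kodairaSymbolAt ((Rat.HeightOneSpectrum.primesEquiv (R := ℤ)).symm ⟨p, hp⟩) ≠
        .Istar n) →
      padicValInt p W.minimalDiscriminantInt ≤ 4 →
      (p = 5 → padicValInt p W.minimalDiscriminantInt ≠ 2) →
      ¬ (p : ℤ) ∣ D.maninConstant := by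
  intro hM hAU hC hnf W _ _ _ D hD p hp h57 hpN hodd hdy hred hN hdeg hI hv hII5
  by_cases hcell : (p = 5 ∧ padicValInt 5 W.minimalDiscriminantInt = 4) ∨
      (p = 7 ∧ padicValInt 7 W.minimalDiscriminantInt = 3)
  · -- the Raynaud rows: K15b by name
    have hp2 : p ≠ 2 := by rcases h57 with rfl | rfl <;> norm_num
    exact hK hM hAU hC hnf W D p hp hcell hpN hred
      (quadraticTwist_pStar_additive_of_twistMinimal W hp hp2 hpN hodd) hD
  · -- off the Raynaud rows: the restricted stub
    refine hA' hM hAU hC hnf W D hD p hp h57 hpN hodd hdy hred hN hdeg hI hv hII5 ?_ ?_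
    · rintro rfl h4
      exact hcell (Or.inl ⟨rfl, h4⟩)
    · rintro rfl h3
      exact hcell (Or.inr ⟨rfl, h3⟩)

end Summit.BirchSwinnertonDyer.BirchSwinnertonDyer.Theorems

end
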